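import Summits.QuantumFields.BalabanUV.Beta.FP.NestedStepLawTorusInstanceDelta
import Summits.QuantumFields.BalabanUV.Beta.FP.NestedStepLawTransportedExp
import Summits.QuantumFields.BalabanUV.Beta.FP.CoarseJetUnit

/-!
# `BalabanUV.Beta.FP.NestedStepLawTorusTransported` — road «FP» for binder row D1, ROUTE T, (T-INST-j) in presentation T-β: **THE TORUS CALL WITH THE CHART
# TRANSPORT INSERTED FIRST** — `NestedStepLawTransportedExp.secondVar_oneShot_nestedStepLaw_expTransported_of_letters` at the δ-constrained composite of record
# (`NestedStepLawTorusInstanceDelta`, p316503): ZERO Faddeev–Popov defect in the conclusion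

WHAT.  The Delta torus call (p316503) reads p308750 at the torus objects of record (`H₀ Q₁₀ τ₁ τ₂ D₁ D₂ D̄ P Q₂₀` by defining equations, `G = 0`) with nine binders
discharged (`h1 c0 hTW hPW b0 b1 b2 d0 h2`) and DISPLAYS the FP defect `2·sV(P·W) − 2·sV([τ₂Q₁;τ₁]·W)`.  By the owner's F-FP-18-1 (`NestedStepLawTransported`, T-β with
the WHOLE composite transported) that defect is the artefact of reading p308750 along the one-shot family; this file is the same call with the transport inserted
first, in the exponential currency confirmed at the record by leaf-02 g18 (`PeriodisedBorderIndexWard`: the averaging-block transport is `A₁ = −c•E_λ`,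
`Ā₁ = c•R_λ`, DIAGONAL multiplications — a one-parameter group): **`secondVar_oneShot_nestedStepLaw_torus_transported`** — the SAME nine binders discharged by the
SAME swarm theorems (leaf-05 `torus_h1` ∕ `torus_h2_record`, gan24-leaf-05 (C1)(C2) + MASTER-COARSE via `torus_cov₁ ∕ torus_cov₂ ∕ torus_cov₀'`, leaf-06 (UNI)
`torus_uni₁ ∕ torus_uni₂ ∕ torus_uniP`, leaf-02 `compWard_b*`), the jets `H₁ H₂ Q₁₁ Q₁₂ Q₂₁ Q₂₂ W₁ W₂ D̄₁ D̄₂` and the rows `a* c1 c2 d1 d2` displayed VERBATIM as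
in the Delta (all read along the NESTED family), PLUS the T-β letters displayed at the torus types: the transport generators `X` (fields), `X̄` (composite
multipliers); (T-β-1) the ONE-SHOT literal's jets NAMED as the `X`-conjugated words `k1 k2 q1 q2`; (T-β-4) the intertwining `j1 j2` with the one-shot chart's
generator jets `W♯₁ W♯₂` and a unimodular parameter transport `C₁ C₂` (`uC`); the six DEAD-ROW letters `p1 p2` (big comb rows along the one-shot family),
`s1 s2` (small comb rows along the nested family), `t1 t2` (coarse comb rows of the average along the nested family — with `c1 c2` they read `τ₂·D̄ₙ = 0`; first
refusal leaf-06 g18 `NestedStepLawTransportedDeadRows`, leaf-02 g18 `torus_t1_of_average_dead`).  CONCLUSION: the ONE-SHOT literal's sliced 2-jet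
`secondVar (kkt H₀ [𝔔₀;P]) (kkt H♯₁ [𝔔♯₁;0]) (kkt H♯₂ [𝔔♯₂;0])` `=` fine level-`j` one-step sliced 2-jet `+` coarse sliced 2-jet (the Delta's two terms VERBATIM)
— NO defect term.  §2 **`secondVar_oneShot_nestedStepLaw_torus_transported_levelUp`**: the same with the coarse term read ONE LEVEL UP by leaf-05 g26's
`CoarseJetUnit.torus_coarse_secondVar_of_hId` (p317669) under an2's displayed identifications `hId₁ hId₂` (Q-FP-16-5) — the SELF-SIMILAR, DEFECT-FREE finite-`j`
law «one-shot `(j, 2)` literal `=` one-step `(j)` `+` one-step `(j+1)`» in the shape that telescopes and polarises (`SecondVarPolarisation.mixedVar_comb_of_secondVar_comb`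
wants exactly two terms on the right).  [folklore] composition BY NAME; no `def`, no `def … : Prop`, nothing cited, 0 sorry.

HONEST DEPENDENCY (page 1, mandatory): continuum YM on T⁴ ⇐ BetaPertH ∧ nine spine estimates (0/9 proved); BetaPertH ⇐ (D1) ∧ (D4) ∧ CAP+tail;
G-an2-4 gates asym, D1 and NE2/3/4.  HONEST FRAMING (cell contract, verbatim): «discharging `BetaPertH` makes Bałaban's UV stability UNCONDITIONAL —
a real constructive-QFT result; it is NOT the continuum limit and NOT the Clay problem.»  ABSOLUTE RULE (cell charter, verbatim): «No internally-minted
statement may enter as a cited fact. Every hypothesis is either kernel-proved in this package or a verbatim quotation of a PUBLISHED theorem with page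
reference. The manuscript(s) under audit are NOT citable for their own disputed steps — they are the thing under adjudication; programme-internal
(2001/route/tribunal) claims are never citable.»  0∕4 row-D1 binders; the displayed letters are the dictionary's TABLE IDENTITIES (leaf-02 ∕ leaf-06 ∕ an2);
NOT (T-ID) complete, NOT SDF, NOT D1, NOT BetaPertH, NOT continuum, NOT Clay.  Road «FP» OWNER, b2b-balaban-beta-d1-p3 gen 18, 2026-08-22.  No existing file touched.
-/

noncomputable section

namespace Summit.QuantumFields.BalabanUV.Beta.FP.NestedStepLawTorusTransported

open Matrix Finset
open Literature.Probability.LatticeModels (Torus.proj)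
open Literature.MathematicalPhysics.QuantumFieldTheory.Balaban1983to89
open Literature.MathematicalPhysics.QuantumFieldTheory.Balaban1983to89.Beta
open Literature.MathematicalPhysics.QuantumFieldTheory.Balaban1983to89.Beta.Composition (kkt)
open Literature.MathematicalPhysics.QuantumFieldTheory.Balaban1983to89.Beta.CompositionSingular (effForm flucCov minOp minOpL)
open B5Prop11Plancherel (fine)
open B6Lemma24Torus (pbox mem_pbox)
open AffineAveraging (Site box toSite)
open OneStepResolventKernel (Fib)
open Summit.QuantumFields.BalabanUV.Beta.BorderedHessian (bhKStepAt stepScale)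
open Summit.QuantumFields.BalabanUV.Beta.D1BFx.LogDetSecondVariation (secondVar)
open Summit.QuantumFields.BalabanUV.Beta.FP.KernelPeriodisationFib (Idx perF)
open Summit.QuantumFields.BalabanUV.Beta.FP.TorusGaugeCovariance (tgrad)
open Summit.QuantumFields.BalabanUV.Beta.FP.TorusGaugeCovarianceCoarse (coarsePt tgradBlock coarsePt_coe)
open Summit.QuantumFields.BalabanUV.Beta.FP.TorusCombRows (Res combRowsT)
open Summit.QuantumFields.BalabanUV.Beta.FP.TorusCombNestedBasis (resBigEquiv)
open Summit.QuantumFields.BalabanUV.Beta.FP.NestedStepLawOneShotLetters (det_ne_zero_of_abs_det det_nestedSlice_mul_gauge_ne_zero)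
open Summit.QuantumFields.BalabanUV.Beta.FP.CompositeWardLetters (compWard_b0 compWard_b1 compWard_b2)
open Summit.QuantumFields.BalabanUV.Beta.FP.NestedStepLawTorusInstance (torus_h1 torus_cov₁ torus_cov₂ torus_uni₁ torus_uni₂ torus_uni₂_ne_zero torus_uniP
  coarseSlot_injective coarseSlot_range)
open Summit.QuantumFields.BalabanUV.Beta.FP.NestedStepLawTorusInstanceDelta (torus_cov₀')
open Summit.QuantumFields.BalabanUV.Beta.FP.RelInvPeriodisedEffFormCoarse (torus_h2_record)
open Summit.QuantumFields.BalabanUV.Beta.FP.NestedStepLawTransportedExp (secondVar_oneShot_nestedStepLaw_expTransported_of_letters)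
open Summit.QuantumFields.BalabanUV.Beta.GAN24.FineReadoutCauchyFrame (toSite_mem_range)
open Summit.QuantumFields.BalabanUV.Beta.FP.CoarseJetUnit (torus_coarse_secondVar_of_hId)
open BalabanStepJetsSucc (wVH)

variable {d : ℕ}

section Transported

variable (M' : Fin (d + 1) → ℕ) [∀ μ, NeZero (M' μ)] {Lc : ℕ} [NeZero Lc] {r r' : Fin (d + 1) → ℕ}

set_option synthInstance.maxSize 1024 in
/-- [folklore] **THE TORUS CALL, TRANSPORT FIRST (T-β), δ-CONSTRAINED COMPOSITE — ZERO FADDEEV–POPOV DEFECT.**  `NestedStepLawTorusInstanceDelta.secondVar_oneShot_nestedStepLaw_torus_delta`'s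
objects, jets and rows VERBATIM (read along the NESTED family), the same nine binders discharged, plus the T-β letters at the torus types: transport generators `X X̄`,
the one-shot literal's jets `H♯₁ H♯₂ 𝔔♯₁ 𝔔♯₂` NAMED as conjugated words (`k1 k2 q1 q2`), the intertwining `j1 j2` with the one-shot chart's generator jets `W♯₁ W♯₂`
and unimodular parameter-transport jets `C₁ C₂` (`uC`), and the six dead-row letters `p1 p2 s1 s2 t1 t2`.  CONCLUSION: the one-shot literal's sliced 2-jet `=`
fine one-step sliced 2-jet `+` coarse sliced 2-jet, with NO defect. -/
theorem secondVar_oneShot_nestedStepLaw_torus_transported (hr : r ∈ box (d + 1) Lc) (hr' : r' ∈ box (d + 1) Lc) (hM' : ∀ i, Lc ∣ M' i) (j : ℕ)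
    {κ : Type*} [Fintype κ] [DecidableEq κ] (pμ' : κ → ↥(pbox M')) (mμ' : κ → Fin (d + 1))
    (hfμ' : Function.Injective (fun a : κ => ((pμ' a, Sum.inr (mμ' a)) : Idx M' (Fib d))))
    (hcoarse' : ∀ (s : ↥(pbox M')) (m : Fin (d + 1)),
      ((s, Sum.inr m) : Idx M' (Fib d)) ∈ Set.range (fun a : κ => ((pμ' a, Sum.inr (mμ' a)) : Idx M' (Fib d))) ↔ Torus.proj Lc (s : Site (d + 1)) = 0)
    -- the torus objects of record, by defining equations
    {H₀ : Matrix (↥(pbox (fine Lc M')) × Fin (d + 1)) (↥(pbox (fine Lc M')) × Fin (d + 1)) ℝ}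
    {Q₁₀ : Matrix (↥(pbox M') × Fin (d + 1)) (↥(pbox (fine Lc M')) × Fin (d + 1)) ℝ}
    {τ₁ : Matrix (Res (toSite r) Lc (fine Lc M')) (↥(pbox (fine Lc M')) × Fin (d + 1)) ℝ}
    {τ₂ : Matrix (Res (toSite r') Lc M') (↥(pbox M') × Fin (d + 1)) ℝ}
    {D₁ : Matrix (↥(pbox (fine Lc M')) × Fin (d + 1)) (Res (toSite r) Lc (fine Lc M')) ℝ}
    {D₂ : Matrix (↥(pbox (fine Lc M')) × Fin (d + 1)) (Res (toSite r') Lc M') ℝ}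
    {Dbar : Matrix (↥(pbox M') × Fin (d + 1)) (Res (toSite r') Lc M') ℝ}
    {P : Matrix (Res (toSite r') Lc M' ⊕ Res (toSite r) Lc (fine Lc M')) (↥(pbox (fine Lc M')) × Fin (d + 1)) ℝ}
    (hH₀ : H₀ = (perF (fine Lc M') (bhKStepAt d (toSite r) Lc j)).submatrix
        (fun b : ↥(pbox (fine Lc M')) × Fin (d + 1) => ((b.1, Sum.inl b.2) : Idx (fine Lc M') (Fib d)))
        (fun b : ↥(pbox (fine Lc M')) × Fin (d + 1) => ((b.1, Sum.inl b.2) : Idx (fine Lc M') (Fib d))))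
    (hQ₁₀ : Q₁₀ = (perF (fine Lc M') (bhKStepAt d (toSite r) Lc j)).submatrix
        (fun a : ↥(pbox M') × Fin (d + 1) => ((coarsePt M' Lc a.1, Sum.inr a.2) : Idx (fine Lc M') (Fib d)))
        (fun b : ↥(pbox (fine Lc M')) × Fin (d + 1) => ((b.1, Sum.inl b.2) : Idx (fine Lc M') (Fib d))))
    (hτ₁ : τ₁ = (combRowsT (toSite r) Lc (fine Lc M')).submatrix id
        (fun b : ↥(pbox (fine Lc M')) × Fin (d + 1) => ((b.1, Sum.inl b.2) : Idx (fine Lc M') (Fib d))))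
    (hτ₂ : τ₂ = (combRowsT (toSite r') Lc M').submatrix id (fun b : ↥(pbox M') × Fin (d + 1) => ((b.1, Sum.inl b.2) : Idx M' (Fib d))))
    (hD₁ : D₁ = (tgrad (fine Lc M')).submatrix (fun b : ↥(pbox (fine Lc M')) × Fin (d + 1) => ((b.1, Sum.inl b.2) : Idx (fine Lc M') (Fib d)))
        (Subtype.val : Res (toSite r) Lc (fine Lc M') → ↥(pbox (fine Lc M'))))
    (hD₂ : D₂ = (tgradBlock M' Lc).submatrix (fun b : ↥(pbox (fine Lc M')) × Fin (d + 1) => ((b.1, Sum.inl b.2) : Idx (fine Lc M') (Fib d)))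
        (Subtype.val : Res (toSite r') Lc M' → ↥(pbox M')))
    (hDbar : Dbar = Matrix.of fun (a : ↥(pbox M') × Fin (d + 1)) (t : Res (toSite r') Lc M') =>
        stepScale d Lc j * (((box (d + 1) Lc).card : ℝ) * tgrad M' (a.1, Sum.inl a.2) t.1))
    (hP : P = (combRowsT ((Lc : ℤ) • toSite r' + toSite r) (Lc * Lc) (fine Lc M')).submatrix
        (resBigEquiv Lc Lc (toSite r) (toSite r') M' (Nat.pos_of_ne_zero (NeZero.ne Lc)) (toSite_mem_range hr)
          (Nat.pos_of_ne_zero (NeZero.ne Lc)) (toSite_mem_range hr')).symm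
        (fun b : ↥(pbox (fine Lc M')) × Fin (d + 1) => ((b.1, Sum.inl b.2) : Idx (fine Lc M') (Fib d))))
    -- the displayed jets: form, averaging (both levels), block covariance, generators (fine and coarse), Ward witnesses
    (H₁ H₂ : Matrix (↥(pbox (fine Lc M')) × Fin (d + 1)) (↥(pbox (fine Lc M')) × Fin (d + 1)) ℝ)
    {Q₂₀ : Matrix κ (↥(pbox M') × Fin (d + 1)) ℝ}
    (hQ₂₀ : Q₂₀ = (perF M' (bhKStepAt d (toSite r') Lc (j + 1))).submatrix (fun a : κ => ((pμ' a, Sum.inr (mμ' a)) : Idx M' (Fib d)))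
        (fun b : ↥(pbox M') × Fin (d + 1) => ((b.1, Sum.inl b.2) : Idx M' (Fib d))))
    (Q₁₁ Q₁₂ : Matrix (↥(pbox M') × Fin (d + 1)) (↥(pbox (fine Lc M')) × Fin (d + 1)) ℝ) (Q₂₁ Q₂₂ : Matrix κ (↥(pbox M') × Fin (d + 1)) ℝ)
    (W₁ W₂ : Matrix (↥(pbox (fine Lc M')) × Fin (d + 1)) (Res (toSite r') Lc M' ⊕ Res (toSite r) Lc (fine Lc M')) ℝ)
    (Db₁ Db₂ : Matrix (↥(pbox M') × Fin (d + 1)) (Res (toSite r') Lc M') ℝ)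
    (Y₀ Y₁ Y₂ Y'₀ Y'₁ Y'₂ : Matrix κ (Res (toSite r') Lc M' ⊕ Res (toSite r) Lc (fine Lc M')) ℝ)
    -- the chart transport (exponential currency): generators `X` (fields), `X̄` (composite multipliers); the one-shot chart's generator jets `W♯₁ W♯₂`;
    -- the parameter-transport jets `C₁ C₂`
    (X : Matrix (↥(pbox (fine Lc M')) × Fin (d + 1)) (↥(pbox (fine Lc M')) × Fin (d + 1)) ℝ) (Xbar : Matrix κ κ ℝ)
    (W'₁ W'₂ : Matrix (↥(pbox (fine Lc M')) × Fin (d + 1)) (Res (toSite r') Lc M' ⊕ Res (toSite r) Lc (fine Lc M')) ℝ)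
    (C₁ C₂ : Matrix (Res (toSite r') Lc M' ⊕ Res (toSite r) Lc (fine Lc M')) (Res (toSite r') Lc M' ⊕ Res (toSite r) Lc (fine Lc M')) ℝ)
    {𝔔₀ 𝔔₁ 𝔔₂ : Matrix κ (↥(pbox (fine Lc M')) × Fin (d + 1)) ℝ}
    (h𝔔₀ : Q₂₀ * Q₁₀ = 𝔔₀) (h𝔔₁ : Q₂₁ * Q₁₀ + Q₂₀ * Q₁₁ = 𝔔₁) (h𝔔₂ : Q₂₂ * Q₁₀ + Q₂₁ * Q₁₁ + (Q₂₁ * Q₁₁ + Q₂₀ * Q₁₂) = 𝔔₂)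
    -- (T-β-1) the ONE-SHOT literal's composite jets are the `X`-conjugated words of the nested-chart jets (`𝔎 = H`: δ-constrained), NAMED
    {H'₁ H'₂ : Matrix (↥(pbox (fine Lc M')) × Fin (d + 1)) (↥(pbox (fine Lc M')) × Fin (d + 1)) ℝ}
    {𝔔'₁ 𝔔'₂ : Matrix κ (↥(pbox (fine Lc M')) × Fin (d + 1)) ℝ}
    (k1 : Xᵀ * H₀ + H₁ + H₀ * X = H'₁)
    (k2 : (X * X)ᵀ * H₀ + (Xᵀ * H₁ + Xᵀ * H₀ * X) + ((Xᵀ * H₁ + Xᵀ * H₀ * X) + (H₂ + H₁ * X + (H₁ * X + H₀ * (X * X)))) = H'₂)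
    (q1 : Xbar * 𝔔₀ + 𝔔₁ + 𝔔₀ * X = 𝔔'₁)
    (q2 : Xbar * Xbar * 𝔔₀ + (Xbar * 𝔔₁ + Xbar * 𝔔₀ * X) + ((Xbar * 𝔔₁ + Xbar * 𝔔₀ * X) + (𝔔₂ + 𝔔₁ * X + (𝔔₁ * X + 𝔔₀ * (X * X)))) = 𝔔'₂)
    -- (T-β-4) intertwining of the transported nested-chart generators with the one-shot chart's generators, unimodular parameter transport
    (j1 : -X * fromCols D₂ D₁ + W₁ = W'₁ + fromCols D₂ D₁ * C₁)
    (j2 : X * X * fromCols D₂ D₁ + (2 : ℝ) • (-X * W₁) + W₂ = W'₂ + (2 : ℝ) • (W'₁ * C₁) + fromCols D₂ D₁ * C₂)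
    (uC : secondVar (1 : Matrix (Res (toSite r') Lc M' ⊕ Res (toSite r) Lc (fine Lc M')) (Res (toSite r') Lc M' ⊕ Res (toSite r) Lc (fine Lc M')) ℝ) C₁ C₂ = 0)
    -- dead rows: the big comb rows along the one-shot family; the small comb rows and the coarse comb rows of the average along the nested family
    (p1 : P * W'₁ = 0) (p2 : P * W'₂ = 0) (s1 : τ₁ * W₁ = 0) (s2 : τ₁ * W₂ = 0)
    (t1 : τ₂ * (Q₁₁ * fromCols D₂ D₁ + Q₁₀ * W₁) = 0) (t2 : τ₂ * (Q₁₂ * fromCols D₂ D₁ + (2 : ℝ) • (Q₁₁ * W₁) + Q₁₀ * W₂) = 0)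
    -- the second-order composite Ward TABLE IDENTITIES (δ-constrained: `𝔎 = H`; p308750's moving shapes, `W₀ := [D₂ | D₁]`) and their transposes
    (a0 : H₀ * fromCols D₂ D₁ = 𝔔₀ᵀ * Y₀) (a1 : H₁ * fromCols D₂ D₁ + H₀ * W₁ = 𝔔₁ᵀ * Y₀ + 𝔔₀ᵀ * Y₁)
    (a2 : H₂ * fromCols D₂ D₁ + (2 : ℝ) • (H₁ * W₁) + H₀ * W₂ = 𝔔₂ᵀ * Y₀ + (2 : ℝ) • (𝔔₁ᵀ * Y₁) + 𝔔₀ᵀ * Y₂)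
    (a0t : H₀ᵀ * fromCols D₂ D₁ = 𝔔₀ᵀ * Y'₀) (a1t : H₁ᵀ * fromCols D₂ D₁ + H₀ᵀ * W₁ = 𝔔₁ᵀ * Y'₀ + 𝔔₀ᵀ * Y'₁)
    (a2t : H₂ᵀ * fromCols D₂ D₁ + (2 : ℝ) • (H₁ᵀ * W₁) + H₀ᵀ * W₂ = 𝔔₂ᵀ * Y'₀ + (2 : ℝ) • (𝔔₁ᵀ * Y'₁) + 𝔔₀ᵀ * Y'₂)
    -- the insertion-table covariance TABLE IDENTITIES (orders 1, 2; leaf-02's jet shapes) and the coarse covariance identities (order 0 discharged)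
    (c1 : Q₁₁ * fromCols D₂ D₁ + Q₁₀ * W₁ = fromCols Db₁ 0) (c2 : Q₁₂ * fromCols D₂ D₁ + (2 : ℝ) • (Q₁₁ * W₁) + Q₁₀ * W₂ = fromCols Db₂ 0)
    (d1 : Q₂₁ * Dbar + Q₂₀ * Db₁ = 0) (d2 : Q₂₂ * Dbar + (2 : ℝ) • (Q₂₁ * Db₁) + Q₂₀ * Db₂ = 0)
    -- block namings and the coarse non-degeneracy
    {Γ : Matrix (↥(pbox (fine Lc M')) × Fin (d + 1)) (↥(pbox (fine Lc M')) × Fin (d + 1)) ℝ}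
    {I : Matrix (↥(pbox (fine Lc M')) × Fin (d + 1)) ((↥(pbox M') × Fin (d + 1)) ⊕ Res (toSite r) Lc (fine Lc M')) ℝ}
    {L : Matrix ((↥(pbox M') × Fin (d + 1)) ⊕ Res (toSite r) Lc (fine Lc M')) (↥(pbox (fine Lc M')) × Fin (d + 1)) ℝ}
    {S : Matrix ((↥(pbox M') × Fin (d + 1)) ⊕ Res (toSite r) Lc (fine Lc M')) ((↥(pbox M') × Fin (d + 1)) ⊕ Res (toSite r) Lc (fine Lc M')) ℝ}
    {B : Matrix ((↥(pbox M') × Fin (d + 1)) ⊕ Res (toSite r) Lc (fine Lc M')) (↥(pbox (fine Lc M')) × Fin (d + 1)) ℝ}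
    (hΓ : flucCov H₀ (fromRows Q₁₀ τ₁) = Γ) (hI : minOp H₀ (fromRows Q₁₀ τ₁) = I) (hL : minOpL H₀ (fromRows Q₁₀ τ₁) = L) (hS : effForm H₀ (fromRows Q₁₀ τ₁) = S)
    (hB : fromRows Q₁₁ (0 : Matrix (Res (toSite r) Lc (fine Lc M')) (↥(pbox (fine Lc M')) × Fin (d + 1)) ℝ) = B) :
    secondVar (kkt H₀ (fromRows 𝔔₀ P))
        (kkt H'₁ (fromRows 𝔔'₁ (0 : Matrix (Res (toSite r') Lc M' ⊕ Res (toSite r) Lc (fine Lc M')) (↥(pbox (fine Lc M')) × Fin (d + 1)) ℝ)))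
        (kkt H'₂ (fromRows 𝔔'₂ (0 : Matrix (Res (toSite r') Lc M' ⊕ Res (toSite r) Lc (fine Lc M')) (↥(pbox (fine Lc M')) × Fin (d + 1)) ℝ)))
      = secondVar (kkt H₀ (fromRows Q₁₀ τ₁)) (kkt H₁ B)
            (kkt H₂ (fromRows Q₁₂ (0 : Matrix (Res (toSite r) Lc (fine Lc M')) (↥(pbox (fine Lc M')) × Fin (d + 1)) ℝ)))
        + secondVar
            (kkt S.toBlocks₁₁ (fromRows Q₂₀ τ₂))
            (kkt ((L * H₁ - S * B) * I - L * Bᵀ * S).toBlocks₁₁ (fromRows Q₂₁ (0 : Matrix (Res (toSite r') Lc M') (↥(pbox M') × Fin (d + 1)) ℝ)))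
            (kkt (((-((L * H₁ - S * B) * Γ + L * Bᵀ * L) * H₁ + L * H₂
                      - (((L * H₁ - S * B) * I - L * Bᵀ * S) * B
                          + S * fromRows Q₁₂ (0 : Matrix (Res (toSite r) Lc (fine Lc M')) (↥(pbox (fine Lc M')) × Fin (d + 1)) ℝ))) * I
                    + (L * H₁ - S * B) * (-((Γ * H₁ + I * B) * I - Γ * Bᵀ * S)))
                  - ((-((L * H₁ - S * B) * Γ + L * Bᵀ * L) * Bᵀ
                        + L * (fromRows Q₁₂ (0 : Matrix (Res (toSite r) Lc (fine Lc M')) (↥(pbox (fine Lc M')) × Fin (d + 1)) ℝ))ᵀ) * S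
                      + L * Bᵀ * ((L * H₁ - S * B) * I - L * Bᵀ * S))).toBlocks₁₁
              (fromRows Q₂₂ (0 : Matrix (Res (toSite r') Lc M') (↥(pbox M') × Fin (d + 1)) ℝ))) := by
  -- the torus binders, exactly as in p313662 ∕ p316503
  have d0 : Q₂₀ * Dbar = 0 := by rw [hQ₂₀, hDbar]; exact torus_cov₀' M' hr' hM' j (j + 1) pμ' mμ'
  have h1 : (kkt H₀ (fromRows Q₁₀ τ₁)).det ≠ 0 := by rw [hH₀, hQ₁₀, hτ₁]; exact torus_h1 M' hr j
  have h₁ : Q₁₀ * D₁ = 0 := by rw [hQ₁₀, hD₁]; exact torus_cov₁ M' hr j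
  have h₂ : Q₁₀ * D₂ = Dbar := by rw [hQ₁₀, hD₂, hDbar]; exact torus_cov₂ M' hr j
  have hc₁ : |(τ₁ * D₁).det| = 1 := by rw [hτ₁, hD₁]; exact torus_uni₁ M' hr
  have hc₂ : |(τ₂ * Dbar).det| = |stepScale d Lc j * ((box (d + 1) Lc).card : ℝ)| ^ Fintype.card (Res (toSite r') Lc M') := by
    rw [hτ₂, hDbar]; exact torus_uni₂ M' hr' hM' j
  have hcP : |(P * fromCols D₂ D₁).det| = 1 := by rw [hP, hD₂, hD₁]; exact torus_uniP M' hr hr' hM'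
  have c0 : Q₁₀ * fromCols D₂ D₁ = fromCols Dbar (0 : Matrix (↥(pbox M') × Fin (d + 1)) (Res (toSite r) Lc (fine Lc M')) ℝ) := by
    rw [mul_fromCols, h₂, h₁]
  have b0 := compWard_b0 Q₁₀ Q₂₀ (fromCols D₂ D₁) Dbar c0 d0 h𝔔₀
  have b1 := compWard_b1 Q₁₀ Q₁₁ Q₂₀ Q₂₁ (fromCols D₂ D₁) W₁ Dbar Db₁ c0 c1 d1 h𝔔₀ h𝔔₁
  have b2 := compWard_b2 Q₁₀ Q₁₁ Q₁₂ Q₂₀ Q₂₁ Q₂₂ (fromCols D₂ D₁) W₁ W₂ Dbar Db₁ Db₂ c0 c1 c2 d2 h𝔔₀ h𝔔₁ h𝔔₂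
  have hPW : (P * fromCols D₂ D₁).det ≠ 0 := det_ne_zero_of_abs_det hcP one_ne_zero
  have hTW : (fromRows (τ₂ * Q₁₀) τ₁ * fromCols D₂ D₁).det ≠ 0 :=
    det_nestedSlice_mul_gauge_ne_zero τ₁ τ₂ Q₁₀ D₁ D₂ Dbar h₁ h₂ hc₁ hc₂ one_ne_zero (torus_uni₂_ne_zero M' hr' j)
  -- the transported law (exponential currency) with `G = 0`
  have h := secondVar_oneShot_nestedStepLaw_expTransported_of_letters H₀ H₁ H₂ Q₁₀ Q₁₁ Q₁₂ Q₂₀ Q₂₁ Q₂₂ 0 0 0 τ₁ τ₂ P (fromCols D₂ D₁) W₁ W₂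
    Y₀ Y₁ Y₂ Y'₀ Y'₁ Y'₂ X Xbar W'₁ W'₂ C₁ C₂
    (show H₀ + Q₁₀ᵀ * (0 : Matrix (↥(pbox M') × Fin (d + 1)) (↥(pbox M') × Fin (d + 1)) ℝ) * Q₁₀ = H₀ by simp)
    (show H₁ + (Q₁₁ᵀ * (0 : Matrix (↥(pbox M') × Fin (d + 1)) (↥(pbox M') × Fin (d + 1)) ℝ) * Q₁₀
        + Q₁₀ᵀ * (0 : Matrix (↥(pbox M') × Fin (d + 1)) (↥(pbox M') × Fin (d + 1)) ℝ) * Q₁₀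
        + Q₁₀ᵀ * (0 : Matrix (↥(pbox M') × Fin (d + 1)) (↥(pbox M') × Fin (d + 1)) ℝ) * Q₁₁) = H₁ by simp)
    (show H₂ + ((Q₁₂ᵀ * (0 : Matrix (↥(pbox M') × Fin (d + 1)) (↥(pbox M') × Fin (d + 1)) ℝ) * Q₁₀
          + Q₁₁ᵀ * (0 : Matrix (↥(pbox M') × Fin (d + 1)) (↥(pbox M') × Fin (d + 1)) ℝ) * Q₁₀
          + Q₁₁ᵀ * (0 : Matrix (↥(pbox M') × Fin (d + 1)) (↥(pbox M') × Fin (d + 1)) ℝ) * Q₁₁)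
        + (Q₁₁ᵀ * (0 : Matrix (↥(pbox M') × Fin (d + 1)) (↥(pbox M') × Fin (d + 1)) ℝ) * Q₁₀
          + Q₁₀ᵀ * (0 : Matrix (↥(pbox M') × Fin (d + 1)) (↥(pbox M') × Fin (d + 1)) ℝ) * Q₁₀
          + Q₁₀ᵀ * (0 : Matrix (↥(pbox M') × Fin (d + 1)) (↥(pbox M') × Fin (d + 1)) ℝ) * Q₁₁)
        + (Q₁₁ᵀ * (0 : Matrix (↥(pbox M') × Fin (d + 1)) (↥(pbox M') × Fin (d + 1)) ℝ) * Q₁₁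
          + Q₁₀ᵀ * (0 : Matrix (↥(pbox M') × Fin (d + 1)) (↥(pbox M') × Fin (d + 1)) ℝ) * Q₁₁
          + Q₁₀ᵀ * (0 : Matrix (↥(pbox M') × Fin (d + 1)) (↥(pbox M') × Fin (d + 1)) ℝ) * Q₁₂)) = H₂ by simp)
    h𝔔₀ h𝔔₁ h𝔔₂ k1 k2 q1 q2 j1 j2 uC p1 p2 s1 s2 t1 t2 a0 a1 a2 a0t a1t a2t b0 b1 b2 hPW hTW hΓ hI hL hS hB h1
    (by
      rw [add_zero, ← hS, hH₀, hQ₁₀, hτ₁, hQ₂₀, hτ₂]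
      exact torus_h2_record M' hr j hr' hM' (coarsePt M' Lc) (coarsePt_coe M' Lc) (coarseSlot_injective M') (coarseSlot_range M')
        (fun a : κ => ((pμ' a, Sum.inr (mμ' a)) : Idx M' (Fib d))) hfμ' (fun a => ⟨mμ' a, rfl⟩) hcoarse')
  simpa only [add_zero] using h

/-! ## §2 The coarse term one level up (leaf-05's `CoarseJetUnit`): the self-similar defect-free law -/

set_option synthInstance.maxSize 1024 in
/-- [folklore] **THE TORUS CALL, TRANSPORT FIRST, COARSE TERM READ ONE LEVEL UP** (leaf-05 g26 `CoarseJetUnit.torus_coarse_secondVar_of_hId`, p317669): under an2's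
displayed identifications `hId₁ hId₂` (the effective-form jet words `=` `(wVH (j+1))⁻¹ •` the level-`(j+1)` insertion tables `H′c₁ H′c₂`) the coarse term IS the
level-`(j+1)` sliced one-step 2-jet at the call's own `hH₀`-shape one level up — THE SELF-SIMILAR, DEFECT-FREE FINITE-`j` LAW: one-shot `(j, 2)` literal `=`
one-step `(j)` `+` one-step `(j+1)`, modulo exactly the displayed letters. -/
theorem secondVar_oneShot_nestedStepLaw_torus_transported_levelUp (hr : r ∈ box (d + 1) Lc) (hr' : r' ∈ box (d + 1) Lc) (hM' : ∀ i, Lc ∣ M' i) (j : ℕ)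
    {κ : Type*} [Fintype κ] [DecidableEq κ] (pμ' : κ → ↥(pbox M')) (mμ' : κ → Fin (d + 1))
    (hfμ' : Function.Injective (fun a : κ => ((pμ' a, Sum.inr (mμ' a)) : Idx M' (Fib d))))
    (hcoarse' : ∀ (s : ↥(pbox M')) (m : Fin (d + 1)),
      ((s, Sum.inr m) : Idx M' (Fib d)) ∈ Set.range (fun a : κ => ((pμ' a, Sum.inr (mμ' a)) : Idx M' (Fib d))) ↔ Torus.proj Lc (s : Site (d + 1)) = 0)
    -- the torus objects of record, by defining equations
    {H₀ : Matrix (↥(pbox (fine Lc M')) × Fin (d + 1)) (↥(pbox (fine Lc M')) × Fin (d + 1)) ℝ}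
    {Q₁₀ : Matrix (↥(pbox M') × Fin (d + 1)) (↥(pbox (fine Lc M')) × Fin (d + 1)) ℝ}
    {τ₁ : Matrix (Res (toSite r) Lc (fine Lc M')) (↥(pbox (fine Lc M')) × Fin (d + 1)) ℝ}
    {τ₂ : Matrix (Res (toSite r') Lc M') (↥(pbox M') × Fin (d + 1)) ℝ}
    {D₁ : Matrix (↥(pbox (fine Lc M')) × Fin (d + 1)) (Res (toSite r) Lc (fine Lc M')) ℝ}
    {D₂ : Matrix (↥(pbox (fine Lc M')) × Fin (d + 1)) (Res (toSite r') Lc M') ℝ}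
    {Dbar : Matrix (↥(pbox M') × Fin (d + 1)) (Res (toSite r') Lc M') ℝ}
    {P : Matrix (Res (toSite r') Lc M' ⊕ Res (toSite r) Lc (fine Lc M')) (↥(pbox (fine Lc M')) × Fin (d + 1)) ℝ}
    (hH₀ : H₀ = (perF (fine Lc M') (bhKStepAt d (toSite r) Lc j)).submatrix
        (fun b : ↥(pbox (fine Lc M')) × Fin (d + 1) => ((b.1, Sum.inl b.2) : Idx (fine Lc M') (Fib d)))
        (fun b : ↥(pbox (fine Lc M')) × Fin (d + 1) => ((b.1, Sum.inl b.2) : Idx (fine Lc M') (Fib d))))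
    (hQ₁₀ : Q₁₀ = (perF (fine Lc M') (bhKStepAt d (toSite r) Lc j)).submatrix
        (fun a : ↥(pbox M') × Fin (d + 1) => ((coarsePt M' Lc a.1, Sum.inr a.2) : Idx (fine Lc M') (Fib d)))
        (fun b : ↥(pbox (fine Lc M')) × Fin (d + 1) => ((b.1, Sum.inl b.2) : Idx (fine Lc M') (Fib d))))
    (hτ₁ : τ₁ = (combRowsT (toSite r) Lc (fine Lc M')).submatrix id
        (fun b : ↥(pbox (fine Lc M')) × Fin (d + 1) => ((b.1, Sum.inl b.2) : Idx (fine Lc M') (Fib d))))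
    (hτ₂ : τ₂ = (combRowsT (toSite r') Lc M').submatrix id (fun b : ↥(pbox M') × Fin (d + 1) => ((b.1, Sum.inl b.2) : Idx M' (Fib d))))
    (hD₁ : D₁ = (tgrad (fine Lc M')).submatrix (fun b : ↥(pbox (fine Lc M')) × Fin (d + 1) => ((b.1, Sum.inl b.2) : Idx (fine Lc M') (Fib d)))
        (Subtype.val : Res (toSite r) Lc (fine Lc M') → ↥(pbox (fine Lc M'))))
    (hD₂ : D₂ = (tgradBlock M' Lc).submatrix (fun b : ↥(pbox (fine Lc M')) × Fin (d + 1) => ((b.1, Sum.inl b.2) : Idx (fine Lc M') (Fib d)))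
        (Subtype.val : Res (toSite r') Lc M' → ↥(pbox M')))
    (hDbar : Dbar = Matrix.of fun (a : ↥(pbox M') × Fin (d + 1)) (t : Res (toSite r') Lc M') =>
        stepScale d Lc j * (((box (d + 1) Lc).card : ℝ) * tgrad M' (a.1, Sum.inl a.2) t.1))
    (hP : P = (combRowsT ((Lc : ℤ) • toSite r' + toSite r) (Lc * Lc) (fine Lc M')).submatrix
        (resBigEquiv Lc Lc (toSite r) (toSite r') M' (Nat.pos_of_ne_zero (NeZero.ne Lc)) (toSite_mem_range hr)
          (Nat.pos_of_ne_zero (NeZero.ne Lc)) (toSite_mem_range hr')).symm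
        (fun b : ↥(pbox (fine Lc M')) × Fin (d + 1) => ((b.1, Sum.inl b.2) : Idx (fine Lc M') (Fib d))))
    -- the displayed jets: form, averaging (both levels), block covariance, generators (fine and coarse), Ward witnesses
    (H₁ H₂ : Matrix (↥(pbox (fine Lc M')) × Fin (d + 1)) (↥(pbox (fine Lc M')) × Fin (d + 1)) ℝ)
    {Q₂₀ : Matrix κ (↥(pbox M') × Fin (d + 1)) ℝ}
    (hQ₂₀ : Q₂₀ = (perF M' (bhKStepAt d (toSite r') Lc (j + 1))).submatrix (fun a : κ => ((pμ' a, Sum.inr (mμ' a)) : Idx M' (Fib d)))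
        (fun b : ↥(pbox M') × Fin (d + 1) => ((b.1, Sum.inl b.2) : Idx M' (Fib d))))
    (Q₁₁ Q₁₂ : Matrix (↥(pbox M') × Fin (d + 1)) (↥(pbox (fine Lc M')) × Fin (d + 1)) ℝ) (Q₂₁ Q₂₂ : Matrix κ (↥(pbox M') × Fin (d + 1)) ℝ)
    (W₁ W₂ : Matrix (↥(pbox (fine Lc M')) × Fin (d + 1)) (Res (toSite r') Lc M' ⊕ Res (toSite r) Lc (fine Lc M')) ℝ)
    (Db₁ Db₂ : Matrix (↥(pbox M') × Fin (d + 1)) (Res (toSite r') Lc M') ℝ)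
    (Y₀ Y₁ Y₂ Y'₀ Y'₁ Y'₂ : Matrix κ (Res (toSite r') Lc M' ⊕ Res (toSite r) Lc (fine Lc M')) ℝ)
    -- the chart transport (exponential currency): generators `X` (fields), `X̄` (composite multipliers); the one-shot chart's generator jets `W♯₁ W♯₂`;
    -- the parameter-transport jets `C₁ C₂`
    (X : Matrix (↥(pbox (fine Lc M')) × Fin (d + 1)) (↥(pbox (fine Lc M')) × Fin (d + 1)) ℝ) (Xbar : Matrix κ κ ℝ)
    (W'₁ W'₂ : Matrix (↥(pbox (fine Lc M')) × Fin (d + 1)) (Res (toSite r') Lc M' ⊕ Res (toSite r) Lc (fine Lc M')) ℝ)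
    (C₁ C₂ : Matrix (Res (toSite r') Lc M' ⊕ Res (toSite r) Lc (fine Lc M')) (Res (toSite r') Lc M' ⊕ Res (toSite r) Lc (fine Lc M')) ℝ)
    {𝔔₀ 𝔔₁ 𝔔₂ : Matrix κ (↥(pbox (fine Lc M')) × Fin (d + 1)) ℝ}
    (h𝔔₀ : Q₂₀ * Q₁₀ = 𝔔₀) (h𝔔₁ : Q₂₁ * Q₁₀ + Q₂₀ * Q₁₁ = 𝔔₁) (h𝔔₂ : Q₂₂ * Q₁₀ + Q₂₁ * Q₁₁ + (Q₂₁ * Q₁₁ + Q₂₀ * Q₁₂) = 𝔔₂)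
    -- (T-β-1) the ONE-SHOT literal's composite jets are the `X`-conjugated words of the nested-chart jets (`𝔎 = H`: δ-constrained), NAMED
    {H'₁ H'₂ : Matrix (↥(pbox (fine Lc M')) × Fin (d + 1)) (↥(pbox (fine Lc M')) × Fin (d + 1)) ℝ}
    {𝔔'₁ 𝔔'₂ : Matrix κ (↥(pbox (fine Lc M')) × Fin (d + 1)) ℝ}
    (k1 : Xᵀ * H₀ + H₁ + H₀ * X = H'₁)
    (k2 : (X * X)ᵀ * H₀ + (Xᵀ * H₁ + Xᵀ * H₀ * X) + ((Xᵀ * H₁ + Xᵀ * H₀ * X) + (H₂ + H₁ * X + (H₁ * X + H₀ * (X * X)))) = H'₂)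
    (q1 : Xbar * 𝔔₀ + 𝔔₁ + 𝔔₀ * X = 𝔔'₁)
    (q2 : Xbar * Xbar * 𝔔₀ + (Xbar * 𝔔₁ + Xbar * 𝔔₀ * X) + ((Xbar * 𝔔₁ + Xbar * 𝔔₀ * X) + (𝔔₂ + 𝔔₁ * X + (𝔔₁ * X + 𝔔₀ * (X * X)))) = 𝔔'₂)
    -- (T-β-4) intertwining of the transported nested-chart generators with the one-shot chart's generators, unimodular parameter transport
    (j1 : -X * fromCols D₂ D₁ + W₁ = W'₁ + fromCols D₂ D₁ * C₁)
    (j2 : X * X * fromCols D₂ D₁ + (2 : ℝ) • (-X * W₁) + W₂ = W'₂ + (2 : ℝ) • (W'₁ * C₁) + fromCols D₂ D₁ * C₂)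
    (uC : secondVar (1 : Matrix (Res (toSite r') Lc M' ⊕ Res (toSite r) Lc (fine Lc M')) (Res (toSite r') Lc M' ⊕ Res (toSite r) Lc (fine Lc M')) ℝ) C₁ C₂ = 0)
    -- dead rows: the big comb rows along the one-shot family; the small comb rows and the coarse comb rows of the average along the nested family
    (p1 : P * W'₁ = 0) (p2 : P * W'₂ = 0) (s1 : τ₁ * W₁ = 0) (s2 : τ₁ * W₂ = 0)
    (t1 : τ₂ * (Q₁₁ * fromCols D₂ D₁ + Q₁₀ * W₁) = 0) (t2 : τ₂ * (Q₁₂ * fromCols D₂ D₁ + (2 : ℝ) • (Q₁₁ * W₁) + Q₁₀ * W₂) = 0)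
    -- the second-order composite Ward TABLE IDENTITIES (δ-constrained: `𝔎 = H`; p308750's moving shapes, `W₀ := [D₂ | D₁]`) and their transposes
    (a0 : H₀ * fromCols D₂ D₁ = 𝔔₀ᵀ * Y₀) (a1 : H₁ * fromCols D₂ D₁ + H₀ * W₁ = 𝔔₁ᵀ * Y₀ + 𝔔₀ᵀ * Y₁)
    (a2 : H₂ * fromCols D₂ D₁ + (2 : ℝ) • (H₁ * W₁) + H₀ * W₂ = 𝔔₂ᵀ * Y₀ + (2 : ℝ) • (𝔔₁ᵀ * Y₁) + 𝔔₀ᵀ * Y₂)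
    (a0t : H₀ᵀ * fromCols D₂ D₁ = 𝔔₀ᵀ * Y'₀) (a1t : H₁ᵀ * fromCols D₂ D₁ + H₀ᵀ * W₁ = 𝔔₁ᵀ * Y'₀ + 𝔔₀ᵀ * Y'₁)
    (a2t : H₂ᵀ * fromCols D₂ D₁ + (2 : ℝ) • (H₁ᵀ * W₁) + H₀ᵀ * W₂ = 𝔔₂ᵀ * Y'₀ + (2 : ℝ) • (𝔔₁ᵀ * Y'₁) + 𝔔₀ᵀ * Y'₂)
    -- the insertion-table covariance TABLE IDENTITIES (orders 1, 2; leaf-02's jet shapes) and the coarse covariance identities (order 0 discharged)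
    (c1 : Q₁₁ * fromCols D₂ D₁ + Q₁₀ * W₁ = fromCols Db₁ 0) (c2 : Q₁₂ * fromCols D₂ D₁ + (2 : ℝ) • (Q₁₁ * W₁) + Q₁₀ * W₂ = fromCols Db₂ 0)
    (d1 : Q₂₁ * Dbar + Q₂₀ * Db₁ = 0) (d2 : Q₂₂ * Dbar + (2 : ℝ) • (Q₂₁ * Db₁) + Q₂₀ * Db₂ = 0)
    -- block namings and the coarse non-degeneracy
    {Γ : Matrix (↥(pbox (fine Lc M')) × Fin (d + 1)) (↥(pbox (fine Lc M')) × Fin (d + 1)) ℝ}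
    {I : Matrix (↥(pbox (fine Lc M')) × Fin (d + 1)) ((↥(pbox M') × Fin (d + 1)) ⊕ Res (toSite r) Lc (fine Lc M')) ℝ}
    {L : Matrix ((↥(pbox M') × Fin (d + 1)) ⊕ Res (toSite r) Lc (fine Lc M')) (↥(pbox (fine Lc M')) × Fin (d + 1)) ℝ}
    {S : Matrix ((↥(pbox M') × Fin (d + 1)) ⊕ Res (toSite r) Lc (fine Lc M')) ((↥(pbox M') × Fin (d + 1)) ⊕ Res (toSite r) Lc (fine Lc M')) ℝ}
    {B : Matrix ((↥(pbox M') × Fin (d + 1)) ⊕ Res (toSite r) Lc (fine Lc M')) (↥(pbox (fine Lc M')) × Fin (d + 1)) ℝ}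
    (hΓ : flucCov H₀ (fromRows Q₁₀ τ₁) = Γ) (hI : minOp H₀ (fromRows Q₁₀ τ₁) = I) (hL : minOpL H₀ (fromRows Q₁₀ τ₁) = L) (hS : effForm H₀ (fromRows Q₁₀ τ₁) = S)
    (hB : fromRows Q₁₁ (0 : Matrix (Res (toSite r) Lc (fine Lc M')) (↥(pbox (fine Lc M')) × Fin (d + 1)) ℝ) = B)
    -- THE DICTIONARY AT ORDERS 1–2 (DISPLAYED; an2's Q-FP-16-5): the effective-form jet words = the unit⁻¹ • the level-(j+1) insertion tables
    {H'c₁ H'c₂ : Matrix (↥(pbox M') × Fin (d + 1)) (↥(pbox M') × Fin (d + 1)) ℝ}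
    (hId₁ : ((L * H₁ - S * B) * I - L * Bᵀ * S).toBlocks₁₁ = (wVH d Lc (j + 1))⁻¹ • H'c₁)
    (hId₂ : (((-((L * H₁ - S * B) * Γ + L * Bᵀ * L) * H₁ + L * H₂
                      - (((L * H₁ - S * B) * I - L * Bᵀ * S) * B
                          + S * fromRows Q₁₂ (0 : Matrix (Res (toSite r) Lc (fine Lc M')) (↥(pbox (fine Lc M')) × Fin (d + 1)) ℝ))) * I
                    + (L * H₁ - S * B) * (-((Γ * H₁ + I * B) * I - Γ * Bᵀ * S)))
                  - ((-((L * H₁ - S * B) * Γ + L * Bᵀ * L) * Bᵀ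
                        + L * (fromRows Q₁₂ (0 : Matrix (Res (toSite r) Lc (fine Lc M')) (↥(pbox (fine Lc M')) × Fin (d + 1)) ℝ))ᵀ) * S
                      + L * Bᵀ * ((L * H₁ - S * B) * I - L * Bᵀ * S))).toBlocks₁₁ = (wVH d Lc (j + 1))⁻¹ • H'c₂) :
    secondVar (kkt H₀ (fromRows 𝔔₀ P))
        (kkt H'₁ (fromRows 𝔔'₁ (0 : Matrix (Res (toSite r') Lc M' ⊕ Res (toSite r) Lc (fine Lc M')) (↥(pbox (fine Lc M')) × Fin (d + 1)) ℝ)))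
        (kkt H'₂ (fromRows 𝔔'₂ (0 : Matrix (Res (toSite r') Lc M' ⊕ Res (toSite r) Lc (fine Lc M')) (↥(pbox (fine Lc M')) × Fin (d + 1)) ℝ)))
      = secondVar (kkt H₀ (fromRows Q₁₀ τ₁)) (kkt H₁ B)
            (kkt H₂ (fromRows Q₁₂ (0 : Matrix (Res (toSite r) Lc (fine Lc M')) (↥(pbox (fine Lc M')) × Fin (d + 1)) ℝ)))
        + secondVar
            (kkt ((perF M' (bhKStepAt d (toSite r') Lc (j + 1))).submatrix
                (fun b : ↥(pbox M') × Fin (d + 1) => ((b.1, Sum.inl b.2) : Idx M' (Fib d)))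
                (fun b : ↥(pbox M') × Fin (d + 1) => ((b.1, Sum.inl b.2) : Idx M' (Fib d))))
              (fromRows Q₂₀ τ₂))
            (kkt H'c₁ (fromRows Q₂₁ (0 : Matrix (Res (toSite r') Lc M') (↥(pbox M') × Fin (d + 1)) ℝ)))
            (kkt H'c₂ (fromRows Q₂₂ (0 : Matrix (Res (toSite r') Lc M') (↥(pbox M') × Fin (d + 1)) ℝ))) := by
  rw [← torus_coarse_secondVar_of_hId M' hr j r' (coarsePt M' Lc) (coarsePt_coe M' Lc) (coarseSlot_injective M') (coarseSlot_range M')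
    hH₀ hQ₁₀ hτ₁ hS Q₂₀ Q₂₁ Q₂₂ τ₂ hId₁ hId₂]
  exact secondVar_oneShot_nestedStepLaw_torus_transported M' hr hr' hM' j pμ' mμ' hfμ' hcoarse' hH₀ hQ₁₀ hτ₁ hτ₂ hD₁ hD₂ hDbar hP H₁ H₂ hQ₂₀ Q₁₁ Q₁₂ Q₂₁ Q₂₂
    W₁ W₂ Db₁ Db₂ Y₀ Y₁ Y₂ Y'₀ Y'₁ Y'₂ X Xbar W'₁ W'₂ C₁ C₂ h𝔔₀ h𝔔₁ h𝔔₂ k1 k2 q1 q2 j1 j2 uC p1 p2 s1 s2 t1 t2 a0 a1 a2 a0t a1t a2t c1 c2 d1 d2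
    hΓ hI hL hS hB

end Transported

end Summit.QuantumFields.BalabanUV.Beta.FP.NestedStepLawTorusTransported

end
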